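import Summits.Ventures.HodgeRepro.Tier3OrbitRational

/-!
# The rational projector onto a Galois-stable coordinate subspace — the Weil line `W_F(B)` as a
`ℚ`-subspace with its `ℚ`-rational projector `e`, on the kernel

Blind re-derivation cell `pub-hodge-repro`, seat `t3-p4` (Tier 3, T3.5 for T3.4 = Lemma R).  Target tree path
`lean/Summits/Ventures/HodgeRepro/Tier3WeilProjector.lean`; imports the cell's `Tier3OrbitRational` (hence
`Tier3SubspaceDescent`: Speiser's lemma `baseChange_rationalPart_eq`, and `Tier3OrbitDescent`:
`tmul_one_mem_baseChange_iff`).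

WHAT THIS FILE STATES (LEMMA-R-RESIDUE.md §4(b)–(c): «`W_F(B) ⊗ ℂ = ⊕_σ ⊗_i ℓ^{(i)}_σ`, in particular `W_F(B) ⊂ K`
(M1's footnote) … the projector of `K ⊗ ℂ` onto `⊕_σ K_{(σ,…,σ)} = W_F(B) ⊗ ℂ` is the action of a `ℚ`-RATIONAL
element … `e · K = W_F(B)` and `e` restricted to `K` is a `ℚ`-linear projector onto `W_F(B)`»).  Abstractly: `K/F₀`
is a finite Galois extension (`F/ℚ`), `V` an `F₀`-space (`H^{2p}(B, ℚ)`), `E` a `K`-basis of `K ⊗[F₀] V` that is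
Galois-equivariant up to units (`(σ ⊗ 1) E_i = u(σ, i) • E_{σ • i}` — the coordinate wedges of an equivariant
eigenbasis, `Tier3WedgeBaseChange`), and `T` a Galois-stable finite set of indices (the `σ`-lines
`{(i, σ) : i ∈ ι}`, `σ ∈ Gal`).

* `baseChange_sup` — base change commutes with `⊔`.
* `isCompl_comap_mk_of_isCompl` — the rational parts of two complementary Galois-stable `K`-subspaces of
  `K ⊗[F₀] V` are complementary `F₀`-subspaces of `V` (Speiser + faithful flatness).
* **`exists_rational_projector`** — there are an `F₀`-subspace `W ≤ V` (the Weil line) and an `F₀`-linear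
  projector `e₀ : V → V` onto `W` with `W ⊗ K = span_K {E_i : i ∈ T}` and, for every `v ∈ V`,
  `1 ⊗ e₀ v = Σ_{i ∈ T} c_i • E_i` where `c = E.repr (1 ⊗ v)`: the rational projector IS the coordinate
  projection onto the lines of `T` after base change.
* `finrank_eq_card_of_baseChange_eq_span` — `dim_{F₀} W = |T|`; for `T` in bijection with `Gal(K/F₀)`,
  `dim_{F₀} W = [K : F₀]` (`finrank_eq_finrank_of_baseChange_eq_span_image`), the input of
  `Tier3WeilRankOne.exists_smul_eq_of_finrank_eq`.

HONESTY.  Linear algebra over a finite Galois extension; no definition is introduced (the rational part of a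
`K`-subspace is written out as `(U.restrictScalars F₀).comap (TensorProduct.mk F₀ K V 1)`, as in
`Tier3SubspaceDescent`); nothing geometric is built.  What stays on paper is that the rational projector so
obtained is the action of the idempotent `e_{O_Δ} ∈ F^{⊗ 2p}` by pull-backs along endomorphisms of `B`
(LEMMA-R-RESIDUE.md §3–§4, (S2)).  HC_CM is NOT proved by anyone in this repository.
-/

set_option autoImplicit false

open TensorProduct

namespace HodgeRepro.Tier3

variable {F₀ K : Type*} [Field F₀] [Field K] [Algebra F₀ K]
variable {V : Type*} [AddCommGroup V] [Module F₀ V]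

/-! ### Base change and `⊔`, complements of rational parts -/

/-- Base change commutes with `⊔`: `(W ⊔ W').baseChange K = W.baseChange K ⊔ W'.baseChange K`. -/
theorem baseChange_sup (W W' : Submodule F₀ V) :
    (W ⊔ W').baseChange K = W.baseChange K ⊔ W'.baseChange K := by
  refine le_antisymm ?_ (sup_le (Submodule.baseChange_mono K le_sup_left)
    (Submodule.baseChange_mono K le_sup_right))
  rw [Submodule.baseChange_eq_span, Submodule.span_le]
  rintro _ ⟨v, hv, rfl⟩
  obtain ⟨w, hw, w', hw', rfl⟩ := Submodule.mem_sup.mp hv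
  rw [SetLike.mem_coe, TensorProduct.mk_apply, TensorProduct.tmul_add]
  exact Submodule.add_mem _ (Submodule.mem_sup_left (Submodule.tmul_mem_baseChange_of_mem 1 hw))
    (Submodule.mem_sup_right (Submodule.tmul_mem_baseChange_of_mem 1 hw'))

section Compl

variable [FiniteDimensional F₀ K] [IsGalois F₀ K]

/-- **Rational parts of complementary Galois-stable subspaces are complementary.**  If `U`, `U'` are
complementary `K`-subspaces of `K ⊗[F₀] V`, both stable under every `σ ⊗ 1`, then their rational parts
`{v : 1 ⊗ v ∈ U}`, `{v : 1 ⊗ v ∈ U'}` are complementary `F₀`-subspaces of `V`. -/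
theorem isCompl_comap_mk_of_isCompl (U U' : Submodule K (K ⊗[F₀] V))
    (hU : ∀ (σ : K ≃ₐ[F₀] K), ∀ u ∈ U, LinearMap.rTensor V σ.toLinearMap u ∈ U)
    (hU' : ∀ (σ : K ≃ₐ[F₀] K), ∀ u ∈ U', LinearMap.rTensor V σ.toLinearMap u ∈ U')
    (h : IsCompl U U') :
    IsCompl ((U.restrictScalars F₀).comap (TensorProduct.mk F₀ K V 1))
      ((U'.restrictScalars F₀).comap (TensorProduct.mk F₀ K V 1)) := by
  have hW := baseChange_rationalPart_eq U hU
  have hW' := baseChange_rationalPart_eq U' hU'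
  refine ⟨?_, ?_⟩
  · rw [Submodule.disjoint_def]
    intro v hv hv'
    have h1 : (1 : K) ⊗ₜ[F₀] v ∈ U ⊓ U' := ⟨hv, hv'⟩
    rw [h.inf_eq_bot, Submodule.mem_bot] at h1
    exact (tmul_one_eq_zero_iff v).mp h1
  · rw [codisjoint_iff, eq_top_iff]
    intro v _
    rw [← tmul_one_mem_baseChange_iff (K := K), baseChange_sup, hW, hW', h.sup_eq_top]
    exact Submodule.mem_top

end Compl

/-! ### The rational projector onto a Galois-stable coordinate subspace -/

section Projector

variable {ι : Type*} [Fintype ι] [DecidableEq ι] [MulAction (K ≃ₐ[F₀] K) ι]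

omit [Fintype ι] [DecidableEq ι] [MulAction (K ≃ₐ[F₀] K) ι] in
/-- The `K`-projection onto `U` along a complement `U'` reads off the `U`-summand of a decomposition. -/
theorem projection_add_eq_of_isCompl (U U' : Submodule K (K ⊗[F₀] V)) (h : IsCompl U U')
    {a b : K ⊗[F₀] V} (ha : a ∈ U) (hb : b ∈ U') : U.projection U' h (a + b) = a := by
  rw [map_add, Submodule.projection_apply, Submodule.projection_apply,
    Submodule.projectionOnto_apply_of_mem_left h ha, Submodule.projectionOnto_apply_of_mem_right h hb,
    Submodule.coe_zero, add_zero]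

omit [Fintype ι] [DecidableEq ι] in
/-- The span of the lines of the complement of a Galois-stable set is Galois-stable. -/
theorem rTensor_mem_span_image_compl_of_equiv (E : Module.Basis ι K (K ⊗[F₀] V))
    (u : (K ≃ₐ[F₀] K) → ι → K)
    (hequiv : ∀ (σ : K ≃ₐ[F₀] K) (i : ι), LinearMap.rTensor V σ.toLinearMap (E i) = u σ i • E (σ • i))
    (T : Set ι) (hT : ∀ (σ : K ≃ₐ[F₀] K), ∀ i ∈ T, σ • i ∈ T) (σ : K ≃ₐ[F₀] K) :
    ∀ w ∈ Submodule.span K (E '' Tᶜ),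
      LinearMap.rTensor V σ.toLinearMap w ∈ Submodule.span K (E '' Tᶜ) := by
  refine rTensor_mem_span_image_of_equiv E u hequiv Tᶜ (fun τ i hi hτ => hi ?_) σ
  have := hT τ⁻¹ _ hτ
  rwa [inv_smul_smul] at this

omit [MulAction (K ≃ₐ[F₀] K) ι] in
/-- The spans of the lines of `T` and of its complement are complementary `K`-subspaces. -/
theorem isCompl_span_image_compl (E : Module.Basis ι K (K ⊗[F₀] V)) (T : Finset ι) :
    IsCompl (Submodule.span K (E '' (T : Set ι))) (Submodule.span K (E '' ((Tᶜ : Finset ι) : Set ι))) := by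
  refine ⟨E.linearIndependent.disjoint_span_image ?_, ?_⟩
  · rw [Finset.coe_compl]
    exact disjoint_compl_right
  · rw [codisjoint_iff, ← Submodule.span_union, ← Set.image_union, Finset.coe_compl,
      Set.union_compl_self, Set.image_univ, E.span_eq]

variable [FiniteDimensional F₀ K] [IsGalois F₀ K]

/-- **The rational projector onto the lines of a Galois-stable set** (LEMMA-R-RESIDUE.md §4(b)–(c): the Weil line
`W_F(B)` as a `ℚ`-subspace of `H^{2p}(B, ℚ)` and the `ℚ`-linear projector `e` onto it).  Let `E` be a `K`-basis of
`K ⊗[F₀] V` that is Galois-equivariant up to units, `(σ ⊗ 1) E_i = u(σ, i) • E_{σ • i}`, and `T` a finite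
Galois-stable set of indices.  Then there are an `F₀`-subspace `W ≤ V` and an `F₀`-linear map `e₀ : V → V` with
`W ⊗ K = span_K {E_i : i ∈ T}`, `e₀` a projector onto `W` (`e₀ v ∈ W`, `e₀ w = w` for `w ∈ W`), and
`1 ⊗ e₀ v = Σ_{i ∈ T} c_i • E_i` where `c = E.repr (1 ⊗ v)` — after base change, `e₀` is the coordinate projection
onto the lines of `T`. -/
theorem exists_rational_projector (E : Module.Basis ι K (K ⊗[F₀] V)) (u : (K ≃ₐ[F₀] K) → ι → K)
    (hequiv : ∀ (σ : K ≃ₐ[F₀] K) (i : ι), LinearMap.rTensor V σ.toLinearMap (E i) = u σ i • E (σ • i))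
    (T : Finset ι) (hT : ∀ (σ : K ≃ₐ[F₀] K), ∀ i ∈ T, σ • i ∈ T) :
    ∃ (W : Submodule F₀ V) (e₀ : V →ₗ[F₀] V),
      W.baseChange K = Submodule.span K (E '' (T : Set ι)) ∧
      (∀ v : V, e₀ v ∈ W) ∧ (∀ w ∈ W, e₀ w = w) ∧
      ∀ v : V, (1 : K) ⊗ₜ[F₀] e₀ v = ∑ i ∈ T, E.repr ((1 : K) ⊗ₜ[F₀] v) i • E i := by
  classical
  set U : Submodule K (K ⊗[F₀] V) := Submodule.span K (E '' (T : Set ι)) with hUdef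
  set U' : Submodule K (K ⊗[F₀] V) := Submodule.span K (E '' ((Tᶜ : Finset ι) : Set ι)) with hU'def
  have hTset : ∀ (σ : K ≃ₐ[F₀] K), ∀ i ∈ (T : Set ι), σ • i ∈ (T : Set ι) := fun σ i hi => hT σ i hi
  have hUst : ∀ (σ : K ≃ₐ[F₀] K), ∀ w ∈ U, LinearMap.rTensor V σ.toLinearMap w ∈ U :=
    fun σ => rTensor_mem_span_image_of_equiv E u hequiv (T : Set ι) hTset σ
  have hU'st : ∀ (σ : K ≃ₐ[F₀] K), ∀ w ∈ U', LinearMap.rTensor V σ.toLinearMap w ∈ U' := by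
    intro σ
    have := rTensor_mem_span_image_compl_of_equiv E u hequiv (T : Set ι) hTset σ
    rwa [← Finset.coe_compl] at this
  have hK : IsCompl U U' := isCompl_span_image_compl E T
  set W : Submodule F₀ V := (U.restrictScalars F₀).comap (TensorProduct.mk F₀ K V 1) with hWdef
  set W' : Submodule F₀ V := (U'.restrictScalars F₀).comap (TensorProduct.mk F₀ K V 1) with hW'def
  have hWU : W.baseChange K = U := baseChange_rationalPart_eq U hUst
  have hW'U : W'.baseChange K = U' := baseChange_rationalPart_eq U' hU'st
  have hc : IsCompl W W' := isCompl_comap_mk_of_isCompl U U' hUst hU'st hK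
  refine ⟨W, W.projection W' hc, hWU, fun v => ?_, fun w hw => ?_, fun v => ?_⟩
  · rw [Submodule.projection_apply]
    exact Submodule.coe_mem _
  · rw [Submodule.projection_apply, Submodule.projectionOnto_apply_of_mem_left hc hw]
  · -- the two decompositions of `1 ⊗ v` in `U ⊕ U'`
    have hmemW : W.projection W' hc v ∈ W := by
      rw [Submodule.projection_apply]
      exact Submodule.coe_mem _
    have hmemW' : v - W.projection W' hc v ∈ W' := by
      rw [← Submodule.projectionOnto_apply_eq_zero_iff (p := W) hc, map_sub,
        Submodule.projection_apply, Submodule.projectionOnto_apply_left, sub_self]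
    have h1 : (1 : K) ⊗ₜ[F₀] W.projection W' hc v ∈ U := by
      rw [← hWU]
      exact Submodule.tmul_mem_baseChange_of_mem 1 hmemW
    have h2 : (1 : K) ⊗ₜ[F₀] (v - W.projection W' hc v) ∈ U' := by
      rw [← hW'U]
      exact Submodule.tmul_mem_baseChange_of_mem 1 hmemW'
    have hsumT : ∑ i ∈ T, E.repr ((1 : K) ⊗ₜ[F₀] v) i • E i ∈ U :=
      Submodule.sum_mem _ fun i hi => Submodule.smul_mem _ _ (Submodule.subset_span ⟨i, hi, rfl⟩)
    have hsumTc : ∑ i ∈ Tᶜ, E.repr ((1 : K) ⊗ₜ[F₀] v) i • E i ∈ U' :=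
      Submodule.sum_mem _ fun i hi => Submodule.smul_mem _ _ (Submodule.subset_span ⟨i, hi, rfl⟩)
    have hdec : (1 : K) ⊗ₜ[F₀] v =
        ∑ i ∈ T, E.repr ((1 : K) ⊗ₜ[F₀] v) i • E i + ∑ i ∈ Tᶜ, E.repr ((1 : K) ⊗ₜ[F₀] v) i • E i := by
      rw [Finset.sum_add_sum_compl, E.sum_repr]
    have hdec' : (1 : K) ⊗ₜ[F₀] v =
        (1 : K) ⊗ₜ[F₀] W.projection W' hc v + (1 : K) ⊗ₜ[F₀] (v - W.projection W' hc v) := by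
      rw [← TensorProduct.tmul_add, add_sub_cancel]
    have key1 := projection_add_eq_of_isCompl U U' hK h1 h2
    have key2 := projection_add_eq_of_isCompl U U' hK hsumT hsumTc
    rw [← hdec'] at key1
    rw [← hdec] at key2
    rw [← key1, key2]

end Projector

/-! ### The dimension count -/

section Dimension

variable [FiniteDimensional F₀ K]

/-- `dim_{F₀} W = |T|` when `W ⊗ K` is spanned by the basis vectors of a finite index set `T`. -/
theorem finrank_eq_card_of_baseChange_eq_span {ι : Type*} (E : Module.Basis ι K (K ⊗[F₀] V))
    (T : Finset ι) (W : Submodule F₀ V) (hW : W.baseChange K = Submodule.span K (E '' (T : Set ι))) :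
    Module.finrank F₀ W = T.card := by
  classical
  have h1 : Module.finrank F₀ W = Module.finrank K (K ⊗[F₀] W) :=
    (Module.finrank_baseChange (R := K) (S := F₀) (M' := W)).symm
  have h2 : Module.finrank K (K ⊗[F₀] W) = Module.finrank K (W.baseChange K) :=
    (Submodule.toBaseChange.toLinearEquiv K W).finrank_eq
  have h3 : Submodule.span K (E '' (T : Set ι)) =
      Submodule.span K (Set.range (E ∘ (Subtype.val : ↥(T : Set ι) → ι))) := by
    rw [Set.range_comp, Subtype.range_coe]
  have h4 : Module.finrank K (Submodule.span K (Set.range (E ∘ (Subtype.val : ↥(T : Set ι) → ι)))) =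
      Fintype.card ↥(T : Set ι) :=
    finrank_span_eq_card (E.linearIndependent.comp _ Subtype.val_injective)
  rw [h1, h2, hW, h3, h4]
  simp

variable [IsGalois F₀ K]

/-- `dim_{F₀} W = [K : F₀]` when `W ⊗ K` is spanned by the basis vectors indexed by the image of an injective map
from `Gal(K/F₀)` (one line per embedding — the `σ`-lines of the Weil line, LEMMA-R-RESIDUE.md §4(d)). -/
theorem finrank_eq_finrank_of_baseChange_eq_span_image {ι : Type*} [DecidableEq ι]
    (E : Module.Basis ι K (K ⊗[F₀] V)) (f : (K ≃ₐ[F₀] K) → ι) (hf : Function.Injective f)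
    (W : Submodule F₀ V)
    (hW : W.baseChange K = Submodule.span K (E '' ((Finset.univ.image f : Finset ι) : Set ι))) :
    Module.finrank F₀ W = Module.finrank F₀ K := by
  rw [finrank_eq_card_of_baseChange_eq_span E _ W hW, Finset.card_image_of_injective _ hf,
    Finset.card_univ, Fintype.card_eq_nat_card, IsGalois.card_aut_eq_finrank]

end Dimension

end HodgeRepro.Tier3
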